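import Summits.Ventures.PercRepro2.CaseOneStarCertT1
import Summits.Ventures.PercRepro2.CaseOneGadgetUWA1BBlockIQ0
import Summits.Ventures.PercRepro2.CaseOneGadgetUWA1BBlockIQ1
import Summits.Ventures.PercRepro2.CaseOneGadgetUWA1BBlockIQ2
import Summits.Ventures.PercRepro2.CaseOneGadgetUWA1BBlockIQ3
import Summits.Ventures.PercRepro2.CaseOneGadgetUWA1BBlockIQ4
import Summits.Ventures.PercRepro2.CaseOneGadgetUWA1BBlockIQ5
import Summits.Ventures.PercRepro2.CaseOneGadgetUWA1BBlockIQ6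
import Summits.Ventures.PercRepro2.CaseOneGadgetUWA1BBlockIQ7R
import Summits.Ventures.PercRepro2.CaseOneGadgetUWA1BBlockIQ8
import Summits.Ventures.PercRepro2.CaseOneGadgetUWA1BBlockIQ9R
import Summits.Ventures.PercRepro2.CaseOneGadgetUWA1BBlockIQ10
import Summits.Ventures.PercRepro2.CaseOneGadgetUWA1BBlockIQ11
import Summits.Ventures.PercRepro2.CaseOneGadgetUWA1BBlockIQ12
import Summits.Ventures.PercRepro2.CaseOneGadgetUWA1BBlockIQ13
import Summits.Ventures.PercRepro2.CaseOneGadgetUWA1BBlockIQ14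

/-!
# The gadget `u ~ {w, a₁, b}`, `w ~ {u, a₂, o}` (uwa1b): the cell certificates of `iqAB5` (part 76i)
(blind cell PercRepro2, p1 g34; the fourth gadget anchor of the six-form calculus — all six forms of the uwa1b gadget
as plain SFacts-cone certificate chains, generated by mining/p1/g34/uwa1b/genu.py = p1 g33's gent_uwa1.py / g25's
geno.py re-targeted; P1-G33 §6–§6″, P1-G34)

Each `eBABIQ ijk kl` is a nonnegative combination of `(pairwise atom) × (cell)` and cubic cell monomials — or, for the degree-4 ones, `M × eBABIQ ijk kl` (`M = Σ cᵢ` the total cell mass) is a nonnegative combination of `(atom) × (cell) × (cell)` and quartic cell monomials, then `SFacts.nonneg_of_sum_mul` (`CaseOneStarCertT1`) — exact LP certificates (kit j319447, every certificate re-verified exactly; data/p1/g33/gcerts_i_uwa1b.json, form `i-Q`), here as exact `linear_combination`s over `SFacts` (the rational coefficients cleared by their common denominator). -/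

namespace Summit.Ventures.PercRepro2

namespace CaseOne

section CertABIQ76i
variable {R : Type*} [Field R] [LinearOrder R] [IsStrictOrderedRing R]

set_option maxHeartbeats 0 in
/-- `eBABIQ33332 ≥ 0`: the combination is identically zero (`ring`). -/
lemma eBABIQ33332_nonneg (m : SCells R) (_hf : SFacts m) : 0 ≤ eBABIQ33332 m := by
  have h : eBABIQ33332 m = 0 := by
    unfold eBABIQ33332 cBABIQ00132 cBABIQ01032 cBABIQ01132 cBABIQ01232 cBABIQ02132 cBABIQ02232 cBABIQ02332 cBABIQ03232 cBABIQ03332 cBABIQ10132 cBABIQ10232 cBABIQ11032 cBABIQ11132 cBABIQ11232 cBABIQ11332 cBABIQ12032 cBABIQ12132 cBABIQ12232 cBABIQ12332 cBABIQ13132 cBABIQ13232 cBABIQ13332 cBABIQ20232 cBABIQ21132 cBABIQ21232 cBABIQ21332 cBABIQ22032 cBABIQ22132 cBABIQ22232 cBABIQ22332 cBABIQ23032 cBABIQ23132 cBABIQ23232 cBABIQ23332 cBABIQ31232 cBABIQ31332 cBABIQ32132 cBABIQ32232 cBABIQ32332 cBABIQ33032 cBABIQ33132 cBABIQ33232 c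BABIQ33332
    ring
  linarith [h]

end CertABIQ76i

end CaseOne

end Summit.Ventures.PercRepro2
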